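import Literature.MathematicalPhysics.QuantumFieldTheory.Balaban1983to89.B11Ineq189

/-!
# `Balaban1983to89.B11Ineq189Census` — [Balaban1985Variational] p. 308, inequality (189): the TERM CENSUS of the
# author-omitted second differentiation of V(A′) («We do not perform these calculations here») TYPED ROW BY ROW in the
# majorant calculus of `B11SectG` ∕ `B11Ineq189` — each of the 16 term-types of the cell note
# `b2b-balaban-b11/SECOND-DERIVATIVE-189.md` §5 as a kernel theorem «majorants of the FIXED printed operators around the
# local analytic leaf ∕ the located δ𝔇 ⟹ a majorant θ_T·e^{−¼δ₀d} from the N-size to the output size», and the assembly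

statement-level skeleton of published theorems with citation tags; proofs where landed; nothing here is a claim about
the Yang–Mills mass gap.

CITATION HEADER (lean-in-tree rule 2026-08-18).  Source under audit: T. Bałaban, *The variational problem and background
fields in renormalization group method for lattice gauge theories*, Commun. Math. Phys. **102**, 277–309 (1985)
[Balaban1985Variational] (cell paper B11; p. 308 (189), pp. 291–292 (85)–(96), pp. 288–289 (66)–(73)); references of the
paper: [3] = [Balaban1984PropagatorsII] (Lemma 2.1, (2.52)–(2.56)), [4] = [Balaban1985Averaging] (Props. 4, 5, 7), [5] =
[Balaban1985BackgroundPropagators] ((3.132)–(3.133)).  The displays are quoted verbatim in `B11Ineq189` ∕ `B11SectG`;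
nothing of the series is asserted here: every printed operator enters through a majorant HYPOTHESIS of the printed shape,
and what is PROVED is the bookkeeping of rates and constants.

WHY THIS FILE EXISTS (YM-DAG node N07 = [B11]; -b seat `pub-ymgap-dag-n21-b` re-pointed by dag-lead
[DAGLEAD-G0-REBALANCE-13-N21B-N07]; cell GAPS G-B11-G2).  `B11Ineq189` kernel-checks the SHAPES of the (189) census — the
joint majorant of the located unprinted intermediate δ𝔇 = (δ²/δA′²)D (`d2D_shape`, `d2D_hasMaj₂`), the contraction of a
δ𝔇-family against a bounded configuration (`term189_of_d2D`) and the assembly (`ineq189_of_terms`) — and leaves the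
census itself («one row per printed term of (85), (88)–(96)», `SECOND-DERIVATIVE-189.md` §5) as PROSE.  The -b seat
`pub-ymgap-dag-n07-b` landed the local analytic leaf U2 in norm form (`B11Ineq189LocalLeaf`: ‖D²C(X)‖ ≤ 9C₂;
`B11Ineq189LeafCk` for [4]'s C_k).  THIS FILE TYPES THE 16 ROWS: for each term-type, which fixed operators sandwich which
leaf, at which rates, with which constant — SHAPE L rows («a chain of FIXED decaying/local operators around ONE factor
𝔇𝔄 or a local leaf ∘ U′𝔄») by the composition rule of [3] (2.52)–(2.56) with Lemma 2.1 summed at σ = ⅛δ₀ (§0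
`comp_quarter`: a factor of rate ≥ ⅜δ₀ preserves the rate ¼δ₀), SHAPE B rows («a δ𝔇-family contracted against a fixed
bounded configuration X») by `B11Ineq189.term189_of_d2D` with the bound M of X itself derived from the printed operator
majorants (§0 `loc_apply_le`); δ𝔇₂ = δ𝔇 − Φ⁰ (the census's «AT A′ = 0» paragraph) is `d2D2_hasMaj₂`; the assembly of the
five groups is `ineq189_of_groups`.

THE ROWS (operators as printed; rates: local∕H∕𝔇∕𝔇*∕(I+ℜ)⁻¹∕U′ at ½δ₀ or better, (QGQ*)⁻¹ at δ₁ ≥ ⅜δ₀ [5] (3.132);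
every conclusion at ¼δ₀, the rate `ineq189_of_terms` consumes):
* T1″ `termT1` ((85): −(δ𝔇₂[𝔄])*·h, h = ⟨HᵀJ⟩ fixed) — SHAPE B.
* T2.1″ `termT21` (Q*(QGQ*)⁻¹(L^jη)⁻¹𝔇𝔄), T2.2″ `termT22` (Q*a(L^jη)⁻¹𝔇𝔄) — SHAPE L; T2.3″ `termT23B` (δ𝔇*[𝔄]·X₃, X₃ =
  (L^jη)⁻¹(QGQ*)⁻¹QA′) + `termT23L` (𝔇*(L^jη)⁻¹(QGQ*)⁻¹Q𝔄); T2.4″ `termT24B` (δ𝔇*[𝔄]·X₄, X₄ = (L^jη)⁻¹aQA′) + `termT24L`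
  (𝔇*(L^jη)⁻¹aQ𝔄) — all from (88).
* T3″ `termT3B` (δ𝔇*[𝔄]·(K₃D(A′))) + `termT3L` (𝔇*K₃𝔇𝔄), K₃ = (L^jη)⁻¹(QGQ*)⁻¹(L^jη)⁻¹ − (L^jη)⁻⁴ — from (89).
* T4.1″ `termT41` (Ξ[𝔄] = ∂²V₀′-leaf ∘ U′), T4.2″ `termT42` (−δ𝔇*[𝔄]·(H*w)), T4.3″ `termT43` (−𝔇*H*Ξ[𝔄]) — from (90).
* T5.L″ `termT5L` ([I or 𝔇*H*] ∘ local bilinear leaf ∘ [I or U′], worst case typed), T5.B″ `termT5B` (−δ𝔇*[𝔄]·(H*q_α)) —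
  from (91)–(96).

HONEST SCOPE.  (1) MAJORANT-LEVEL SHAPES over the abstract `B6.Geometry` ∕ `BlockNorm` carriers: the operators Q, Q*, a,
(QGQ*)⁻¹, H, H*, 𝔇, 𝔇*, U′, K₃, the leaves ∂²V₀′, the bilinear commutator forms and the δ𝔇(₂)-families are VARIABLES with
majorant hypotheses of the printed shapes ((46)∕(69), (71), (73), (3.132), [4] (135) by Cauchy); the identification with the
concrete second derivatives is DIVERGENCE D-B11-10's prose (n07-b's `B11Ineq189LeafCk` and its announced concrete δ𝔇 are
the first instances).  (2) The ε-bookkeeping («size» column of the census: θ_T ≤ O(1)ε₃ in N-units in ∕ (−3)-units out)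
is carried by the constants: every θ_T below is an explicit product of the hypotheses' constants (θ_𝔇 = O(1)C₃ε₃ of (73),
2 of (71), the O(1) of (3.132), B₀ of (46), the bounds M of the fixed configurations from (53)–(55), (77)) and of the
cutting costs κ and the row-sum constant c of Lemma 2.1 at σ = ⅛δ₀; the scale weights (L^jη)^{−1,−2,−3} live inside the
sizes as in `B11SectG`.  (3) Rates are rounded to ¼δ₀ (the census's sharper ½δ₀ ∕ ⅜δ₀ for SHAPE L rows are recorded in
the docstrings, not needed by (189)).  (4) Nothing of (66)–(73), (85)–(96), (189), [4], [5] is asserted; no `def … : Prop`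
is minted; 0 sorry; axioms standard.
-/

namespace Literature.MathematicalPhysics.QuantumFieldTheory.Balaban1983to89.B11Ineq189Census

open Finset B6RandomWalk B11SectG B11Ineq189

variable {g : B6.Geometry}
variable {FA F₀ F₁ F₂ F₃ F₄ : Type} [AddCommGroup FA] [Module ℝ FA] [AddCommGroup F₀] [Module ℝ F₀]
  [AddCommGroup F₁] [Module ℝ F₁] [AddCommGroup F₂] [Module ℝ F₂] [AddCommGroup F₃] [Module ℝ F₃]
  [AddCommGroup F₄] [Module ℝ F₄]

/-! ## §0  The bookkeeping kit: rate ¼δ₀ is preserved by every printed factor (all have rate ≥ ⅜δ₀) -/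

section Kit

variable {δ₀ c : ℝ}

/-- Rounding a rate down to ¼δ₀ (the rate (189) keeps): a majorant `a·e^{−ρd}` with `ρ ≥ ¼δ₀` is a majorant
`a·e^{−¼δ₀d}` (`B11SectG.HasMaj.of_rate_le`). [cite: Balaban1984PropagatorsII, (2.52)–(2.56) pp.232–233] -/
theorem quarter_of_rate {b₁ : BlockNorm g F₁} {b₂ : BlockNorm g F₂} {T : F₁ →ₗ[ℝ] F₂} {a ρ : ℝ}
    (hd : ∀ x y : g.Site, 0 ≤ g.dist x y) (ha : 0 ≤ a) (hρ : δ₀ / 4 ≤ ρ)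
    (h : HasMaj b₁ b₂ T (fun y y' => a * Real.exp (-(ρ * g.dist y y')))) :
    HasMaj b₁ b₂ T (fun y y' => a * Real.exp (-(δ₀ / 4 * g.dist y y'))) :=
  h.of_rate_le hd ha hρ

/-- **THE COMPOSITION RULE OF THE CENSUS**: a FIXED operator `T₁` of majorant `a₁·e^{−ρ₁d}` with `ρ₁ ≥ ⅜δ₀` (every
printed factor: local operators, `H`, `𝔇`, `𝔇*`, `(I+ℜ)⁻¹`, `U′` at `½δ₀` or better, `(QGQ*)⁻¹` at `δ₁ ≥ ⅜δ₀`) after an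
operator `T₂` of majorant `a₂·e^{−¼δ₀d}` has majorant `κ₂a₁a₂c·e^{−¼δ₀d}` — [3] (2.52)–(2.56) with Lemma 2.1 summed at
`σ = ⅛δ₀` (`¼δ₀ + ⅛δ₀ = ⅜δ₀ ≤ ρ₁`). [cite: Balaban1984PropagatorsII, (2.52)–(2.56) pp.232–233 + Lemma 2.1 p.234] -/
theorem comp_quarter {b₁ : BlockNorm g F₁} {b₂ : BlockNorm g F₂} {b₃ : BlockNorm g F₃}
    {T₁ : F₂ →ₗ[ℝ] F₃} {T₂ : F₁ →ₗ[ℝ] F₂} {a₁ a₂ ρ₁ : ℝ}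
    (htri : Triangle254 g) (hd : ∀ x y : g.Site, 0 ≤ g.dist x y) (hδ₀ : 0 ≤ δ₀) (hrow : RowSum g (δ₀ / 8) c)
    (ha₁ : 0 ≤ a₁) (ha₂ : 0 ≤ a₂) (hρ₁ : 3 * δ₀ / 8 ≤ ρ₁)
    (h₁ : HasMaj b₂ b₃ T₁ (fun y y' => a₁ * Real.exp (-(ρ₁ * g.dist y y'))))
    (h₂ : HasMaj b₁ b₂ T₂ (fun y y' => a₂ * Real.exp (-(δ₀ / 4 * g.dist y y')))) :
    HasMaj b₁ b₃ (T₁ ∘ₗ T₂) (fun y y' => b₂.κ * a₁ * a₂ * c * Real.exp (-(δ₀ / 4 * g.dist y y'))) :=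
  hasMaj_comp_exp htri hd hrow ha₁ ha₂ (by linarith) le_rfl (by linarith) h₁ h₂

/-- Two census rows add: `θ₁e^{−¼δ₀d} + θ₂e^{−¼δ₀d} = (θ₁ + θ₂)e^{−¼δ₀d}`. [cite: Balaban1984PropagatorsII, p.232 ("A summation preserves it also")] -/
theorem add_quarter {b₁ : BlockNorm g F₁} {b₂ : BlockNorm g F₂} {T₁ T₂ : F₁ →ₗ[ℝ] F₂} {θ₁ θ₂ : ℝ}
    (h₁ : HasMaj b₁ b₂ T₁ (fun y y' => θ₁ * Real.exp (-(δ₀ / 4 * g.dist y y'))))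
    (h₂ : HasMaj b₁ b₂ T₂ (fun y y' => θ₂ * Real.exp (-(δ₀ / 4 * g.dist y y')))) :
    HasMaj b₁ b₂ (T₁ + T₂) (fun y y' => (θ₁ + θ₂) * Real.exp (-(δ₀ / 4 * g.dist y y'))) :=
  (h₁.add h₂).mono fun y y' => le_of_eq (by ring)

/-- **The size of a FIXED configuration pushed through a fixed operator** (how the census bounds its contracted
configurations X₃ = (L^jη)⁻¹(QGQ*)⁻¹QA′, H*w, K₃D(A′), …): `T` of majorant `a·e^{−ρd}` (`a ≥ 0`, `ρ ≥ ⅛δ₀`) applied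
to `X` of local size `≤ M` everywhere has local size `≤ a·κ₁·M·c` everywhere — the partition of unity (2.52) and the row
sum of Lemma 2.1 [3]. [cite: Balaban1984PropagatorsII, (2.52)–(2.53) p.232 + Lemma 2.1 p.234] -/
theorem loc_apply_le {b₁ : BlockNorm g F₁} {b₂ : BlockNorm g F₂} {T : F₁ →ₗ[ℝ] F₂} {a ρ M : ℝ} {X : F₁}
    (hd : ∀ x y : g.Site, 0 ≤ g.dist x y) (hrow : RowSum g (δ₀ / 8) c) (ha : 0 ≤ a) (hM : 0 ≤ M)
    (hρ : δ₀ / 8 ≤ ρ) (h : HasMaj b₁ b₂ T (fun y y' => a * Real.exp (-(ρ * g.dist y y'))))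
    (hX : ∀ y, b₁.loc y X ≤ M) : ∀ y, b₂.loc y (T X) ≤ a * b₁.κ * M * c := by
  intro y
  have hrow' : RowSum g ρ c := hrow.mono hd hρ
  have hb := h.bound (fun _ _ => mul_nonneg ha (Real.exp_nonneg _)) X y
  refine hb.trans ?_
  calc ∑ y' : g.Site, a * Real.exp (-(ρ * g.dist y y')) * (b₁.κ * b₁.loc y' X)
      ≤ ∑ y' : g.Site, a * Real.exp (-(ρ * g.dist y y')) * (b₁.κ * M) :=
        Finset.sum_le_sum fun y' _ => mul_le_mul_of_nonneg_left
          (mul_le_mul_of_nonneg_left (hX y') b₁.κ_nonneg) (mul_nonneg ha (Real.exp_nonneg _))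
    _ = a * b₁.κ * M * ∑ y' : g.Site, Real.exp (-(ρ * g.dist y y')) := by
        rw [Finset.mul_sum]; exact Finset.sum_congr rfl fun y' _ => by ring
    _ ≤ a * b₁.κ * M * c :=
        mul_le_mul_of_nonneg_left (hrow' y) (mul_nonneg (mul_nonneg ha b₁.κ_nonneg) hM)

end Kit

/-! ## §1  The located intermediate read for the census: δ𝔇₂ = δ𝔇 − Φ⁰ («AT A′ = 0») -/

section D2D2

/-- **δ𝔇₂ = δ(𝔇₂) = δ𝔇 − Φ⁰** (cell note §4 U1, «AT A′ = 0»: `D(0) = 0, 𝔇(0) = 0, ℜ(0) = 0`, so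
`δ𝔇(0)[𝔄]μ = (L^jη)²∂²C_j(0)[μ, 𝔄] = Φ⁰` is purely LOCAL): the family `δ𝔇₂ := δ𝔇 − Φ⁰` has the joint majorant of `δ𝔇`
(`B11Ineq189.d2D_hasMaj₂`'s shape, constant `θ`) plus the local leaf's (`hasMaj₂_local` at the rates `⅛δ₀`, `¼δ₀`, constant
`β⁰a_Ia_A`) — constant `θ + β⁰a_Ia_A`, «again O(1)C₂ (no ε is claimed for δ𝔇₂; none is needed)».
[cite: Balaban1985Variational, p.289 (𝔇₂) + (189) p.308; Balaban1985Averaging, Prop. 4 (134)–(135)] -/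
theorem d2D2_hasMaj₂ {bN : BlockNorm g FA} {b₀ : BlockNorm g F₀} {b₃ : BlockNorm g F₃}
    {T T₀ Φ₀ : FA →ₗ[ℝ] F₀ →ₗ[ℝ] F₃} {δ₀ θ β₀ aI aA : ℝ} (hβ₀ : 0 ≤ β₀) (haI : 0 ≤ aI)
    (hT₀ : HasMaj₂ bN b₀ b₃ T₀
      (fun y y'' y' => θ * Real.exp (-(δ₀ / 8 * g.dist y y'')) * Real.exp (-(δ₀ / 4 * g.dist y y'))))
    (hloc : ∀ y v μ, b₃.loc y (Φ₀ v μ) ≤ β₀ * b₀.loc y μ * bN.loc y v)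
    (hI₀ : HasMaj b₀ b₀ LinearMap.id (fun y y'' => aI * Real.exp (-(δ₀ / 8 * g.dist y y''))))
    (hIA : HasMaj bN bN LinearMap.id (fun y y' => aA * Real.exp (-(δ₀ / 4 * g.dist y y'))))
    (hT : ∀ v μ, T v μ = T₀ v μ - Φ₀ v μ) :
    HasMaj₂ bN b₀ b₃ T
      (fun y y'' y' => (θ + β₀ * aI * aA) * Real.exp (-(δ₀ / 8 * g.dist y y'')) *
        Real.exp (-(δ₀ / 4 * g.dist y y'))) := by
  have hΦ := hasMaj₂_local (T := Φ₀) hβ₀ haI hloc hI₀ hIA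
  refine ((hT₀.sub hΦ).congr fun v μ => ?_).mono fun y y'' y' => le_of_eq (by ring)
  rw [LinearMap.sub_apply, LinearMap.sub_apply, hT]

end D2D2

/-! ## §2  SHAPE L rows: chains of fixed printed operators around 𝔇𝔄 or a local leaf ∘ U′𝔄 -/

section ShapeL

variable {bN : BlockNorm g FA} {b₀ : BlockNorm g F₀} {b₁ : BlockNorm g F₁} {b₂ : BlockNorm g F₂}
  {b₃ : BlockNorm g F₃} {b₄ : BlockNorm g F₄} {δ₀ c : ℝ}

/-- **T2.1″ (from (88)): `Q*(QGQ*)⁻¹(L^jη)⁻¹𝔇𝔄`.**  Operators: `Dop` = `(L^jη)⁻¹𝔇(A′)` acting on the direction 𝔄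
(majorant `θ_𝔇·e^{−½δ₀d}`, (73): *"|𝔇(A′; c, b)| ≤ O(1)C₃ε₃(L^jη)^{−d+1}exp(−½δ₀d(c₋, y))"*), `Ginv` = `(QGQ*)⁻¹` (majorant
`a_G·e^{−δ₁d}`, [5] (3.132), `δ₁ ≥ ⅜δ₀`), `Qs` = `Q*` (local: majorant `a_Q·e^{−½δ₀d}`).  Census rate `min{½δ₀, δ₁ − ⅛δ₀}
≥ ¼δ₀`; size `O(1)·O(1)C₃ε₃` = here `κ₂a_Q·(κ₁a_Gθ_𝔇c)·c`. [cite: Balaban1985Variational, (88) p.291 + (189) p.308] -/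
theorem termT21 {Dop : FA →ₗ[ℝ] F₁} {Ginv : F₁ →ₗ[ℝ] F₂} {Qs : F₂ →ₗ[ℝ] F₃} {θD aG aQ δ₁ : ℝ}
    (htri : Triangle254 g) (hd : ∀ x y : g.Site, 0 ≤ g.dist x y) (hδ₀ : 0 ≤ δ₀) (hrow : RowSum g (δ₀ / 8) c) (hc : 0 ≤ c)
    (hθD : 0 ≤ θD) (haG : 0 ≤ aG) (haQ : 0 ≤ aQ) (hδ₁ : 3 * δ₀ / 8 ≤ δ₁)
    (hD : HasMaj bN b₁ Dop (fun y y' => θD * Real.exp (-(δ₀ / 2 * g.dist y y'))))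
    (hG : HasMaj b₁ b₂ Ginv (fun y y' => aG * Real.exp (-(δ₁ * g.dist y y'))))
    (hQ : HasMaj b₂ b₃ Qs (fun y y' => aQ * Real.exp (-(δ₀ / 2 * g.dist y y')))) :
    HasMaj bN b₃ (Qs ∘ₗ (Ginv ∘ₗ Dop))
      (fun y y' => b₂.κ * aQ * (b₁.κ * aG * θD * c) * c * Real.exp (-(δ₀ / 4 * g.dist y y'))) := by
  have hκ₁ := b₁.κ_nonneg
  have h0 := quarter_of_rate (δ₀ := δ₀) hd hθD (by linarith) hD
  have h1 := comp_quarter htri hd hδ₀ hrow haG hθD hδ₁ hG h0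
  exact comp_quarter htri hd hδ₀ hrow haQ (by positivity) (by linarith) hQ h1

/-- **T2.2″ (from (88)): `Q*a(L^jη)⁻¹𝔇𝔄`** — a LOCAL operator `Qa` = `Q*a(L^jη)⁻¹` (majorant `a·e^{−½δ₀d}`) after `𝔇`
(`θ_𝔇·e^{−½δ₀d}`); census rate `½δ₀`, size `O(1)C₃ε₃`, here `κ₁·a·θ_𝔇·c`. [cite: Balaban1985Variational, (88) p.291 + (189) p.308] -/
theorem termT22 {Dop : FA →ₗ[ℝ] F₁} {Qa : F₁ →ₗ[ℝ] F₃} {θD a : ℝ}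
    (htri : Triangle254 g) (hd : ∀ x y : g.Site, 0 ≤ g.dist x y) (hδ₀ : 0 ≤ δ₀) (hrow : RowSum g (δ₀ / 8) c)
    (hθD : 0 ≤ θD) (ha : 0 ≤ a)
    (hD : HasMaj bN b₁ Dop (fun y y' => θD * Real.exp (-(δ₀ / 2 * g.dist y y'))))
    (hQ : HasMaj b₁ b₃ Qa (fun y y' => a * Real.exp (-(δ₀ / 2 * g.dist y y')))) :
    HasMaj bN b₃ (Qa ∘ₗ Dop) (fun y y' => b₁.κ * a * θD * c * Real.exp (-(δ₀ / 4 * g.dist y y'))) :=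
  comp_quarter htri hd hδ₀ hrow ha hθD (by linarith) hQ (quarter_of_rate (δ₀ := δ₀) hd hθD (by linarith) hD)

/-- **T2.3″ second piece ∕ T2.4″ second piece (from (88)): `𝔇*S Q𝔄`** with `S` = `(L^jη)⁻¹(QGQ*)⁻¹` (majorant `a_S·e^{−δ₁d}`,
`δ₁ ≥ ⅜δ₀`) or `S` = `(L^jη)⁻¹a` (local) — the direction enters through the LOCAL `Q` (majorant `a_Q·e^{−½δ₀d}`), then `S`,
then `𝔇*` (the transposed (73), `θ_𝔇·e^{−½δ₀d}`); census rate `≥ ¼δ₀`, size `O(1)C₃ε₃`, here `κ·θ_𝔇·(κ·a_S·a_Q·c)·c`.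
[cite: Balaban1985Variational, (88) p.291 + (189) p.308] -/
theorem termT23L {Q : FA →ₗ[ℝ] F₁} {S : F₁ →ₗ[ℝ] F₂} {Dst : F₂ →ₗ[ℝ] F₃} {aQ aS θD ρS : ℝ}
    (htri : Triangle254 g) (hd : ∀ x y : g.Site, 0 ≤ g.dist x y) (hδ₀ : 0 ≤ δ₀) (hrow : RowSum g (δ₀ / 8) c) (hc : 0 ≤ c)
    (haQ : 0 ≤ aQ) (haS : 0 ≤ aS) (hθD : 0 ≤ θD) (hρS : 3 * δ₀ / 8 ≤ ρS)
    (hQ : HasMaj bN b₁ Q (fun y y' => aQ * Real.exp (-(δ₀ / 2 * g.dist y y'))))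
    (hS : HasMaj b₁ b₂ S (fun y y' => aS * Real.exp (-(ρS * g.dist y y'))))
    (hDst : HasMaj b₂ b₃ Dst (fun y y' => θD * Real.exp (-(δ₀ / 2 * g.dist y y')))) :
    HasMaj bN b₃ (Dst ∘ₗ (S ∘ₗ Q))
      (fun y y' => b₂.κ * θD * (b₁.κ * aS * aQ * c) * c * Real.exp (-(δ₀ / 4 * g.dist y y'))) := by
  have hκ₁ := b₁.κ_nonneg
  have h0 := quarter_of_rate (δ₀ := δ₀) hd haQ (by linarith) hQ
  have h1 := comp_quarter htri hd hδ₀ hrow haS haQ hρS hS h0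
  exact comp_quarter htri hd hδ₀ hrow hθD (by positivity) (by linarith) hDst h1

/-- **T3″ second piece (from (89)): `𝔇*K₃𝔇𝔄`**, `K₃ = (L^jη)⁻¹(QGQ*)⁻¹(L^jη)⁻¹ − (L^jη)⁻⁴` (fixed, majorant `a_K·e^{−ρ_Kd}`,
`ρ_K ≥ ⅜δ₀`: (3.132) and a local term) between `𝔇` and `𝔇*` (both (73), `½δ₀`) — census rate `⅜δ₀` (two `½δ₀`-factors and
one summation), size `O(1)C₃²ε₃²`, here `κ·θ_𝔇·(κ·a_K·θ_𝔇·c)·c`.  (On (89)'s missing sign: cell erratum E-B11-3 = GAPS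
G-B11-D4, harmless — only absolute values enter.) [cite: Balaban1985Variational, (89) p.291 + (189) p.308] -/
theorem termT3L {Dop : FA →ₗ[ℝ] F₁} {K₃ : F₁ →ₗ[ℝ] F₂} {Dst : F₂ →ₗ[ℝ] F₃} {θD aK θD' ρK : ℝ}
    (htri : Triangle254 g) (hd : ∀ x y : g.Site, 0 ≤ g.dist x y) (hδ₀ : 0 ≤ δ₀) (hrow : RowSum g (δ₀ / 8) c) (hc : 0 ≤ c)
    (hθD : 0 ≤ θD) (haK : 0 ≤ aK) (hθD' : 0 ≤ θD') (hρK : 3 * δ₀ / 8 ≤ ρK)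
    (hD : HasMaj bN b₁ Dop (fun y y' => θD * Real.exp (-(δ₀ / 2 * g.dist y y'))))
    (hK : HasMaj b₁ b₂ K₃ (fun y y' => aK * Real.exp (-(ρK * g.dist y y'))))
    (hDst : HasMaj b₂ b₃ Dst (fun y y' => θD' * Real.exp (-(δ₀ / 2 * g.dist y y')))) :
    HasMaj bN b₃ (Dst ∘ₗ (K₃ ∘ₗ Dop))
      (fun y y' => b₂.κ * θD' * (b₁.κ * aK * θD * c) * c * Real.exp (-(δ₀ / 4 * g.dist y y'))) := by
  have hκ₁ := b₁.κ_nonneg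
  have h0 := quarter_of_rate (δ₀ := δ₀) hd hθD (by linarith) hD
  have h1 := comp_quarter htri hd hδ₀ hrow haK hθD hρK hK h0
  exact comp_quarter htri hd hδ₀ hrow hθD' (by positivity) (by linarith) hDst h1

/-- **T4.1″ (from (90)): `Ξ[𝔄] = Σ_{p∈st(b)} ∂²V₀′(A″, ∂p)[e_b-slot, (U′𝔄)|_{∂p}]`** — the LOCAL second-derivative leaf of
`V₀′` (p. 291 *"with the power of |A| lower by"* two, Cauchy on the plaquette polydisc: a fixed local operator `Leaf` of
majorant `β·e^{−½δ₀d}`, `β = O(1)ε₃(ε₁ + ε₃)` in the census's units) after `U′ = I − H𝔇` (majorant `a_{U′}·e^{−½δ₀d}`,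
(46) + (73)); census rate `½δ₀`, here `κ·β·a_{U′}·c`. [cite: Balaban1985Variational, (90) p.291 + (189) p.308] -/
theorem termT41 {U' : FA →ₗ[ℝ] F₁} {Leaf : F₁ →ₗ[ℝ] F₃} {aU β : ℝ}
    (htri : Triangle254 g) (hd : ∀ x y : g.Site, 0 ≤ g.dist x y) (hδ₀ : 0 ≤ δ₀) (hrow : RowSum g (δ₀ / 8) c)
    (haU : 0 ≤ aU) (hβ : 0 ≤ β)
    (hU : HasMaj bN b₁ U' (fun y y' => aU * Real.exp (-(δ₀ / 2 * g.dist y y'))))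
    (hLeaf : HasMaj b₁ b₃ Leaf (fun y y' => β * Real.exp (-(δ₀ / 2 * g.dist y y')))) :
    HasMaj bN b₃ (Leaf ∘ₗ U') (fun y y' => b₁.κ * β * aU * c * Real.exp (-(δ₀ / 4 * g.dist y y'))) :=
  comp_quarter htri hd hδ₀ hrow hβ haU (by linarith) hLeaf (quarter_of_rate (δ₀ := δ₀) hd haU (by linarith) hU)

/-- **T4.3″ (from (90)): `−𝔇*H*Ξ[𝔄]`** — `Ξ` as in T4.1″ (rate `¼δ₀` after rounding, constant `θ_Ξ`), then `H*` (majorant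
`B₀·e^{−δ_Hd}`, `δ_H ≥ ⅜δ₀`; print uses `δ₀`, (69)∕(86); [5] (3.133)), then `𝔇*` ((73), `½δ₀`); census rate `⅜δ₀`, size
`O(1)C₃B₀ε₃²(ε₁ + ε₃)`, here `κ·θ_𝔇·(κ·B₀·θ_Ξ·c)·c`. [cite: Balaban1985Variational, (90) p.291 + (189) p.308] -/
theorem termT43 {Xi : FA →ₗ[ℝ] F₁} {Hst : F₁ →ₗ[ℝ] F₂} {Dst : F₂ →ₗ[ℝ] F₃} {θΞ B₀ θD δH : ℝ}
    (htri : Triangle254 g) (hd : ∀ x y : g.Site, 0 ≤ g.dist x y) (hδ₀ : 0 ≤ δ₀) (hrow : RowSum g (δ₀ / 8) c) (hc : 0 ≤ c)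
    (hθΞ : 0 ≤ θΞ) (hB₀ : 0 ≤ B₀) (hθD : 0 ≤ θD) (hδH : 3 * δ₀ / 8 ≤ δH)
    (hXi : HasMaj bN b₁ Xi (fun y y' => θΞ * Real.exp (-(δ₀ / 4 * g.dist y y'))))
    (hH : HasMaj b₁ b₂ Hst (fun y y' => B₀ * Real.exp (-(δH * g.dist y y'))))
    (hDst : HasMaj b₂ b₃ Dst (fun y y' => θD * Real.exp (-(δ₀ / 2 * g.dist y y')))) :
    HasMaj bN b₃ (Dst ∘ₗ (Hst ∘ₗ Xi))
      (fun y y' => b₂.κ * θD * (b₁.κ * B₀ * θΞ * c) * c * Real.exp (-(δ₀ / 4 * g.dist y y'))) := by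
  have hκ₁ := b₁.κ_nonneg
  have h1 := comp_quarter htri hd hδ₀ hrow hB₀ hθΞ hδH hH hXi
  exact comp_quarter htri hd hδ₀ hrow hθD (by positivity) (by linarith) hDst h1

/-- **T5.L″ (from (91)–(96)), worst case typed: `𝔇*H* ∘ B_α ∘ U′`** — a LOCAL bilinear commutator form of the cubic
polynomials `P_α(A′, DA′, A″)` with two of its three factors replaced by the directions (explicit; [6] (1.50), (1.52);
p. 292 *"these terms in (93) can be estimated by O(1)|∇A′||A′|"*), read as a fixed local operator `Bα` of majorant
`β_α·e^{−½δ₀d}` (`β_α = O(1)ε₃`) dressed by `U′` on the direction side (`a_{U′}·e^{−½δ₀d}`) and by `𝔇*H*` on the output side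
(`B₀·e^{−δ_Hd}`, `θ_𝔇·e^{−½δ₀d}`); the undressed variants (`I` for `U′` or for `𝔇*H*`) are the sub-chains.  Census rate
`⅜δ₀` (both dressings) or `½δ₀`; here `κθ_𝔇·(κB₀·(κβ_αa_{U′}c)·c)·c`. [cite: Balaban1985Variational, (91)–(96) p.292 + (189) p.308] -/
theorem termT5L {U' : FA →ₗ[ℝ] F₁} {Bα : F₁ →ₗ[ℝ] F₂} {Hst : F₂ →ₗ[ℝ] F₃} {Dst : F₃ →ₗ[ℝ] F₄} {bout : BlockNorm g F₄}
    {aU βα B₀ θD δH : ℝ}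
    (htri : Triangle254 g) (hd : ∀ x y : g.Site, 0 ≤ g.dist x y) (hδ₀ : 0 ≤ δ₀) (hrow : RowSum g (δ₀ / 8) c) (hc : 0 ≤ c)
    (haU : 0 ≤ aU) (hβα : 0 ≤ βα) (hB₀ : 0 ≤ B₀) (hθD : 0 ≤ θD) (hδH : 3 * δ₀ / 8 ≤ δH)
    (hU : HasMaj bN b₁ U' (fun y y' => aU * Real.exp (-(δ₀ / 2 * g.dist y y'))))
    (hB : HasMaj b₁ b₂ Bα (fun y y' => βα * Real.exp (-(δ₀ / 2 * g.dist y y'))))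
    (hH : HasMaj b₂ b₃ Hst (fun y y' => B₀ * Real.exp (-(δH * g.dist y y'))))
    (hDst : HasMaj b₃ bout Dst (fun y y' => θD * Real.exp (-(δ₀ / 2 * g.dist y y')))) :
    HasMaj bN bout (Dst ∘ₗ (Hst ∘ₗ (Bα ∘ₗ U')))
      (fun y y' => b₃.κ * θD * (b₂.κ * B₀ * (b₁.κ * βα * aU * c) * c) * c *
        Real.exp (-(δ₀ / 4 * g.dist y y'))) := by
  have hκ₁ := b₁.κ_nonneg
  have hκ₂ := b₂.κ_nonneg
  have h0 := quarter_of_rate (δ₀ := δ₀) hd haU (by linarith) hU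
  have h1 := comp_quarter htri hd hδ₀ hrow hβα haU (by linarith) hB h0
  have h2 := comp_quarter htri hd hδ₀ hrow hB₀ (by positivity) hδH hH h1
  exact comp_quarter htri hd hδ₀ hrow hθD (by positivity) (by linarith) hDst h2

end ShapeL

/-! ## §3  SHAPE B rows: a δ𝔇-family contracted against a FIXED bounded configuration (rate exactly ¼δ₀) -/

section ShapeB

variable {bN : BlockNorm g FA} {b₀ : BlockNorm g F₀} {b₁ : BlockNorm g F₁} {b₃ : BlockNorm g F₃} {δ₀ c : ℝ}

/-- **T1″ (from (85)): `−(δ𝔇₂[𝔄])*·h`**, `h(c₁) = Σ_{b′}η^d tr J(b′)H(b′,c₁)` FIXED of local size `≤ M_h` (`M_h =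
O(1)C₁B₃B₀ε₁(L^jη)^{−4}`: the first two lines of (86)).  The TRANSPOSED `δ𝔇₂`-family (joint majorant `θ₂′·e^{−⅛δ₀d(y,y″)}
e^{−¼δ₀d(y,y′)}` — `d2D2_hasMaj₂`'s shape for the transpose, kernel bounds being orientation-free, [3] (2.51)) applied to
`h` is a (189)-term with constant `κ·θ₂′·M_h·c` and rate `¼δ₀` (`B11Ineq189.term189_of_d2D`); census size `O(1)C₂·C₁B₃B₀ε₁
≤ O(1)ε₃` by (103). [cite: Balaban1985Variational, (85)–(86) p.291 + (189) p.308] -/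
theorem termT1 {T : FA →ₗ[ℝ] F₀ →ₗ[ℝ] F₃} {h : F₀} {W : FA →ₗ[ℝ] F₃} {θ Mh : ℝ}
    (hd : ∀ x y : g.Site, 0 ≤ g.dist x y) (hrow : RowSum g (δ₀ / 8) c) (hθ : 0 ≤ θ) (hMh : 0 ≤ Mh)
    (hT : HasMaj₂ bN b₀ b₃ T
      (fun y y'' y' => θ * Real.exp (-(δ₀ / 8 * g.dist y y'')) * Real.exp (-(δ₀ / 4 * g.dist y y'))))
    (hh : ∀ y, b₀.loc y h ≤ Mh) (hW : ∀ v, W v = T v h) :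
    HasMaj bN b₃ W (fun y y' => b₀.κ * θ * Mh * c * Real.exp (-(δ₀ / 4 * g.dist y y'))) :=
  term189_of_d2D hd hrow hθ hMh hT hh hW

/-- **T2.3″ ∕ T2.4″ first pieces (from (88)): `δ𝔇*[𝔄]·X` with `X = S(X₀)` FIXED**, `S` = `(L^jη)⁻¹(QGQ*)⁻¹` (majorant
`a_S·e^{−δ₁d}`, `δ₁ ≥ ⅛δ₀` suffices here) or `(L^jη)⁻¹a`, `X₀ = QA′` of local size `≤ M₀` ((77): `|QA′| < ε₃(L^{j′}η)^{−1}`):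
then `|X| ≤ a_S·κ·M₀·c` (`loc_apply_le`: "(3.132) row-summed against |QA′|"), and the transposed `δ𝔇`-family (joint
majorant of `d2D_hasMaj₂`'s shape, constant `θ`) applied to `X` is a (189)-term of constant `κ₀θ·(a_Sκ₁M₀c)·c`, rate `¼δ₀`;
census size `O(1)C₂ε₃`. [cite: Balaban1985Variational, (88) p.291 + (189) p.308; Balaban1985BackgroundPropagators, (3.132) p.422] -/
theorem termT23B {T : FA →ₗ[ℝ] F₀ →ₗ[ℝ] F₃} {S : F₁ →ₗ[ℝ] F₀} {X₀ : F₁} {W : FA →ₗ[ℝ] F₃} {θ aS ρS M₀ : ℝ}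
    (hd : ∀ x y : g.Site, 0 ≤ g.dist x y) (hrow : RowSum g (δ₀ / 8) c) (hc : 0 ≤ c) (hθ : 0 ≤ θ) (haS : 0 ≤ aS) (hM₀ : 0 ≤ M₀)
    (hρS : δ₀ / 8 ≤ ρS)
    (hT : HasMaj₂ bN b₀ b₃ T
      (fun y y'' y' => θ * Real.exp (-(δ₀ / 8 * g.dist y y'')) * Real.exp (-(δ₀ / 4 * g.dist y y'))))
    (hS : HasMaj b₁ b₀ S (fun y y' => aS * Real.exp (-(ρS * g.dist y y'))))
    (hX₀ : ∀ y, b₁.loc y X₀ ≤ M₀) (hW : ∀ v, W v = T v (S X₀)) :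
    HasMaj bN b₃ W (fun y y' => b₀.κ * θ * (aS * b₁.κ * M₀ * c) * c * Real.exp (-(δ₀ / 4 * g.dist y y'))) := by
  have hκ₁ := b₁.κ_nonneg
  have hX : ∀ y, b₀.loc y (S X₀) ≤ aS * b₁.κ * M₀ * c := loc_apply_le hd hrow haS hM₀ hρS hS hX₀
  exact term189_of_d2D hd hrow hθ (by positivity) hT hX hW

/-- **T3″ first piece (from (89)): `δ𝔇*[𝔄]·(K₃D(A′))`** — `X = K₃(D(A′))` with `D(A′)` FIXED of local size `≤ M_D` ((55):
`|D(A′)| ≤ 4C₂|A′|²_{(−1)}`, so `M_D = O(1)C₂ε₃²` in the census's units) and `K₃` of majorant `a_K·e^{−ρ_Kd}` (`ρ_K ≥ ⅛δ₀`):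
the same bookkeeping as `termT23B`; census size `O(1)C₂²ε₃²`, rate `¼δ₀`. [cite: Balaban1985Variational, (55) p.287 + (89) p.291 + (189) p.308] -/
theorem termT3B {T : FA →ₗ[ℝ] F₀ →ₗ[ℝ] F₃} {K₃ : F₁ →ₗ[ℝ] F₀} {DA : F₁} {W : FA →ₗ[ℝ] F₃} {θ aK ρK MD : ℝ}
    (hd : ∀ x y : g.Site, 0 ≤ g.dist x y) (hrow : RowSum g (δ₀ / 8) c) (hc : 0 ≤ c) (hθ : 0 ≤ θ) (haK : 0 ≤ aK) (hMD : 0 ≤ MD)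
    (hρK : δ₀ / 8 ≤ ρK)
    (hT : HasMaj₂ bN b₀ b₃ T
      (fun y y'' y' => θ * Real.exp (-(δ₀ / 8 * g.dist y y'')) * Real.exp (-(δ₀ / 4 * g.dist y y'))))
    (hK : HasMaj b₁ b₀ K₃ (fun y y' => aK * Real.exp (-(ρK * g.dist y y'))))
    (hDA : ∀ y, b₁.loc y DA ≤ MD) (hW : ∀ v, W v = T v (K₃ DA)) :
    HasMaj bN b₃ W (fun y y' => b₀.κ * θ * (aK * b₁.κ * MD * c) * c * Real.exp (-(δ₀ / 4 * g.dist y y'))) :=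
  termT23B hd hrow hc hθ haK hMD hρK hT hK hDA hW

/-- **T4.2″ (from (90)) and T5.B″ (from (91)–(96)): `−δ𝔇*[𝔄]·(H*w)`** — `w` FIXED of local size `≤ M_w` (`w` = the first
line of (90), `M_w = O(1)ε₃²(ε₁ + ε₃)(L^jη)^{−3}` by p. 291; or `w = q_α`, the first derivatives (92)–(96) of the commutator
polynomials, `M_w = O(1)ε₃²`), pushed through `H*` (majorant `B₀·e^{−δ_Hd}`, `δ_H ≥ ⅛δ₀`), then contracted with the
transposed `δ𝔇`-family: constant `κ₀θ·(B₀κ₁M_wc)·c`, rate `¼δ₀`; census sizes `O(1)C₂B₀ε₃²(ε₁ + ε₃)` ∕ `O(1)C₂B₀ε₃²`.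
[cite: Balaban1985Variational, (90)–(96) pp.291–292 + (189) p.308] -/
theorem termT42 {T : FA →ₗ[ℝ] F₀ →ₗ[ℝ] F₃} {Hst : F₁ →ₗ[ℝ] F₀} {w : F₁} {W : FA →ₗ[ℝ] F₃} {θ B₀ δH Mw : ℝ}
    (hd : ∀ x y : g.Site, 0 ≤ g.dist x y) (hrow : RowSum g (δ₀ / 8) c) (hc : 0 ≤ c) (hθ : 0 ≤ θ) (hB₀ : 0 ≤ B₀) (hMw : 0 ≤ Mw)
    (hδH : δ₀ / 8 ≤ δH)
    (hT : HasMaj₂ bN b₀ b₃ T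
      (fun y y'' y' => θ * Real.exp (-(δ₀ / 8 * g.dist y y'')) * Real.exp (-(δ₀ / 4 * g.dist y y'))))
    (hH : HasMaj b₁ b₀ Hst (fun y y' => B₀ * Real.exp (-(δH * g.dist y y'))))
    (hw : ∀ y, b₁.loc y w ≤ Mw) (hW : ∀ v, W v = T v (Hst w)) :
    HasMaj bN b₃ W (fun y y' => b₀.κ * θ * (B₀ * b₁.κ * Mw * c) * c * Real.exp (-(δ₀ / 4 * g.dist y y'))) :=
  termT23B hd hrow hc hθ hB₀ hMw hδH hT hH hw hW

end ShapeB

/-! ## §4  The assembly: the five groups of (85), (88), (89), (90), (91)–(96) -/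

section Assembly

variable {F3 : Type} [AddCommGroup F3] [Module ℝ F3] {bN : BlockNorm g FA} {b3 : BlockNorm g F3} {δ₀ : ℝ}

/-- **(189) FROM THE CENSUS BY GROUPS**: if `(δ²/δA′²)V(A′)[𝔄] = W₁ + W₂ + W₃ + W₄ + W₅` — the contributions of (85), (88),
(89), (90) and of the commutator polynomials (91)–(96) (each group the sum of its rows above) — and each group has a
majorant `θ_i·e^{−¼δ₀d}` from the N-size to the output size, then `B11SectG.Ineq189 bN b3 W (θ₁ + θ₂ + θ₃ + θ₄ + θ₅) δ₀`.
With `B11Ineq189.ineq189_of_terms` this is the whole bookkeeping of p. 308's *"We do not perform these calculations here …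
let us formulate a final result only"*; the ε-count `Σθ_i = O(1)ε₃` is the census's size column (module docstring (2)).
[cite: Balaban1985Variational, (85), (88)–(96) pp.291–292 + (189) p.308] -/
theorem ineq189_of_groups {W W₁ W₂ W₃ W₄ W₅ : FA →ₗ[ℝ] F3} {θ₁ θ₂ θ₃ θ₄ θ₅ : ℝ}
    (h₁ : HasMaj bN b3 W₁ (fun y y' => θ₁ * Real.exp (-(δ₀ / 4 * g.dist y y'))))
    (h₂ : HasMaj bN b3 W₂ (fun y y' => θ₂ * Real.exp (-(δ₀ / 4 * g.dist y y'))))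
    (h₃ : HasMaj bN b3 W₃ (fun y y' => θ₃ * Real.exp (-(δ₀ / 4 * g.dist y y'))))
    (h₄ : HasMaj bN b3 W₄ (fun y y' => θ₄ * Real.exp (-(δ₀ / 4 * g.dist y y'))))
    (h₅ : HasMaj bN b3 W₅ (fun y y' => θ₅ * Real.exp (-(δ₀ / 4 * g.dist y y'))))
    (hW : ∀ v, W v = W₁ v + W₂ v + W₃ v + W₄ v + W₅ v) :
    Ineq189 bN b3 W (θ₁ + θ₂ + θ₃ + θ₄ + θ₅) δ₀ := by
  have h := add_quarter (add_quarter (add_quarter (add_quarter h₁ h₂) h₃) h₄) h₅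
  unfold Ineq189
  refine h.congr fun v => ?_
  simp only [LinearMap.add_apply, hW]

/-- **Group (88) assembled from its six rows** (T2.1″, T2.2″, T2.3″ (two pieces), T2.4″ (two pieces)): six (189)-terms at
rate `¼δ₀` add to the group `W₂` with constant the sum of the six. [cite: Balaban1985Variational, (88) p.291 + (189) p.308] -/
theorem group88_of_rows {W₂ R₁ R₂ R₃ R₄ R₅ R₆ : FA →ₗ[ℝ] F3} {t₁ t₂ t₃ t₄ t₅ t₆ : ℝ}
    (h₁ : HasMaj bN b3 R₁ (fun y y' => t₁ * Real.exp (-(δ₀ / 4 * g.dist y y'))))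
    (h₂ : HasMaj bN b3 R₂ (fun y y' => t₂ * Real.exp (-(δ₀ / 4 * g.dist y y'))))
    (h₃ : HasMaj bN b3 R₃ (fun y y' => t₃ * Real.exp (-(δ₀ / 4 * g.dist y y'))))
    (h₄ : HasMaj bN b3 R₄ (fun y y' => t₄ * Real.exp (-(δ₀ / 4 * g.dist y y'))))
    (h₅ : HasMaj bN b3 R₅ (fun y y' => t₅ * Real.exp (-(δ₀ / 4 * g.dist y y'))))
    (h₆ : HasMaj bN b3 R₆ (fun y y' => t₆ * Real.exp (-(δ₀ / 4 * g.dist y y'))))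
    (hW : ∀ v, W₂ v = R₁ v + R₂ v + R₃ v + R₄ v + R₅ v + R₆ v) :
    HasMaj bN b3 W₂ (fun y y' => (t₁ + t₂ + t₃ + t₄ + t₅ + t₆) * Real.exp (-(δ₀ / 4 * g.dist y y'))) := by
  have h := add_quarter (add_quarter (add_quarter (add_quarter (add_quarter h₁ h₂) h₃) h₄) h₅) h₆
  refine h.congr fun v => ?_
  simp only [LinearMap.add_apply, hW]

/-- A group of TWO rows ((85) = T1″ alone needs none; (89) = T3″'s two pieces; each polynomial of (91)–(96) = T5.L″ + T5.B″).
[cite: Balaban1985Variational, (89) p.291 + (91)–(96) p.292 + (189) p.308] -/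
theorem group_of_two_rows {Wg R₁ R₂ : FA →ₗ[ℝ] F3} {t₁ t₂ : ℝ}
    (h₁ : HasMaj bN b3 R₁ (fun y y' => t₁ * Real.exp (-(δ₀ / 4 * g.dist y y'))))
    (h₂ : HasMaj bN b3 R₂ (fun y y' => t₂ * Real.exp (-(δ₀ / 4 * g.dist y y'))))
    (hW : ∀ v, Wg v = R₁ v + R₂ v) :
    HasMaj bN b3 Wg (fun y y' => (t₁ + t₂) * Real.exp (-(δ₀ / 4 * g.dist y y'))) :=
  (add_quarter h₁ h₂).congr fun v => by simp only [LinearMap.add_apply, hW]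

/-- A group of THREE rows ((90) = T4.1″ + T4.2″ + T4.3″). [cite: Balaban1985Variational, (90) p.291 + (189) p.308] -/
theorem group_of_three_rows {Wg R₁ R₂ R₃ : FA →ₗ[ℝ] F3} {t₁ t₂ t₃ : ℝ}
    (h₁ : HasMaj bN b3 R₁ (fun y y' => t₁ * Real.exp (-(δ₀ / 4 * g.dist y y'))))
    (h₂ : HasMaj bN b3 R₂ (fun y y' => t₂ * Real.exp (-(δ₀ / 4 * g.dist y y'))))
    (h₃ : HasMaj bN b3 R₃ (fun y y' => t₃ * Real.exp (-(δ₀ / 4 * g.dist y y'))))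
    (hW : ∀ v, Wg v = R₁ v + R₂ v + R₃ v) :
    HasMaj bN b3 Wg (fun y y' => (t₁ + t₂ + t₃) * Real.exp (-(δ₀ / 4 * g.dist y y'))) :=
  (add_quarter (add_quarter h₁ h₂) h₃).congr fun v => by simp only [LinearMap.add_apply, hW]

end Assembly

end Literature.MathematicalPhysics.QuantumFieldTheory.Balaban1983to89.B11Ineq189Census
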